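import Mathlib
import Literature.Analysis.FluidPDE.GaussianVortexPlanar
import Literature.Analysis.FluidPDE.GaussianVortexPlanarProofs
import Literature.Analysis.FluidPDE.BiotSavart2DSymmetry
import Summits.AnomalousDissipation.AnomalousDissipation.Theorems.MarginalStabilityChainStretchedVortexRowsStubCoreInverseTools
import Summits.AnomalousDissipation.AnomalousDissipation.Theorems.MarginalStabilityChainStretchedVortexRowsStubCoreInverseAngular
import Summits.AnomalousDissipation.AnomalousDissipation.Theorems.MarginalStabilityChainStretchedVortexRowsStubCoreRotationLocalSkew
import Summits.AnomalousDissipation.AnomalousDissipation.Theorems.MarginalStabilityChainStretchedVortexRowsStubHardyWirtingerEven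
import Summits.AnomalousDissipation.AnomalousDissipation.Theorems.MarginalStabilityChainStretchedVortexRowsStubCoreLAngularPairingTools
import Summits.AnomalousDissipation.AnomalousDissipation.Theorems.MarginalStabilityChainStretchedVortexRowsStubInnerIdBiotSavartLogConv
import Summits.AnomalousDissipation.AnomalousDissipation.Theorems.MarginalStabilityChainStretchedVortexRowsStubLogPotentialNeutralEnergy
import Summits.AnomalousDissipation.AnomalousDissipation.Theorems.MarginalStabilityChainStretchedVortexRowsStubCoreInverseIntegrabilityTools
import HarnessLib

/-!
# Helper `coreRotation_coercivity` toward stub `stub_coreInverse` of the line `braid-closed-large-circulation-gluing`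
# (crux stmt-AnomalousDissipation-3009, `MarginalStabilityChain.StretchedVortexRows`)

ROTATION COERCIVITY of the Gaussian vortex at spectral parameter `0`, Biot–Savart part. For even `w = Gu` of the core class put
`g := ∂_θw = Dw[ξ^⊥]` (a `C¹`, even, NEUTRAL, circular-mean-free density of Gaussian class) and `ψ := N∗g`. Then
`ξ·(K∗w)(ξ) = −ψ(ξ)` (`inner_id_biotSavart2D_eq_neg_logConv_angularDeriv`), so
`J := ∫ (ξ·K∗w) ∂_θw = −∫ ψ g = ‖∇ψ‖²_{L²} ≥ 0` (`logPotential_neutral_energy`), and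
`J = −∫ψ g ≤ (∫ GΩ⁻¹ψ²)^{1/2} Θ^{1/2} ≤ (5.6 ∫ψ²/|ξ|²)^{1/2} Θ^{1/2} ≤ (1.4 J)^{1/2} Θ^{1/2}` by the scalar bound
`G Ω⁻¹ |ξ|² = 8x²/(eˣ−1) ≤ 5.6` (`x = |ξ|²/4`) and the Hardy–Wirtinger inequality for even circular-mean-free functions
(`hardyWirtinger_even`), whence `J ≤ (7/5) Θ`, `Θ = ∫ G⁻¹Ω(∂_θw)²`: the Biot–Savart part of `⟨Λ_G w, ∂_θw⟩_{L²(G⁻¹)} = Θ − J/2`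
eats at most `70%` of the local rotation coercivity.
-/

set_option linter.dupNamespace false

noncomputable section

open scoped RealInnerProductSpace Topology
open MeasureTheory WithLp Function Metric Filter Set

namespace Summit.AnomalousDissipation.AnomalousDissipation.Theorems.MarginalStabilityChainStretchedVortexRows

open Literature.Analysis.FluidPDE



/-! ## The scalar bound `8x²/(eˣ − 1) ≤ 5.6` in the form `G Ω⁻¹ ≤ (7/5)·|ξ|⁻²` -/

/-- `(10/7)·8x² ≤ 8(eˣ − 1)`, i.e. `x²/(eˣ−1) ≤ 7/10`, for `x ≥ 0` (Taylor to fourth order; the true maximum is `≈ 0.648`). [folklore] -/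
theorem sq_le_seven_tenths_mul_exp_sub_one {x : ℝ} (hx : 0 ≤ x) : x ^ 2 ≤ 7 / 10 * (Real.exp x - 1) := by
  have hexp : 1 + x + x ^ 2 / 2 + x ^ 3 / 6 + x ^ 4 / 24 ≤ Real.exp x := by
    have h := Real.sum_le_exp_of_nonneg hx 5
    simp only [Finset.sum_range_succ, Finset.sum_range_zero, Nat.factorial, Nat.cast_one, pow_zero,
      pow_one] at h
    norm_num at h
    linarith
  nlinarith [sq_nonneg (x - 17 / 10), mul_nonneg hx (sq_nonneg (x - 2)), mul_nonneg hx (sq_nonneg x),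
    mul_nonneg (mul_nonneg hx hx) (sq_nonneg (x - 1))]

/-- The weight comparison behind the coercivity constant: `G(ξ)|ξ|² ≤ (28/5) Ω(ξ)`, `Ω = (8π)⁻¹φ(|ξ|²/4)`
(i.e. `G Ω⁻¹ |ξ|² = 8x²/(eˣ−1) ≤ 5.6`, `x = |ξ|²/4`). [folklore] -/
theorem gaussVortexProfile_mul_sq_le_omega (ξ : EuclideanSpace ℝ (Fin 2)) :
    gaussVortexProfile ξ * ‖ξ‖ ^ 2 ≤ 28 / 5 * ((8 * Real.pi)⁻¹ * burgersPhi (‖ξ‖ ^ 2 / 4)) := by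
  by_cases hξ : ξ = 0
  · subst hξ
    simp only [norm_zero]
    norm_num
    positivity [burgersPhi_pos (0 / 4 : ℝ)]
  have hr : 0 < ‖ξ‖ := norm_pos_iff.2 hξ
  have hx0' : 0 < ‖ξ‖ ^ 2 / 4 := by positivity
  rw [burgersPhi_of_ne_zero hx0'.ne', gaussVortexProfile]
  set x : ℝ := ‖ξ‖ ^ 2 / 4 with hx
  have hr2 : ‖ξ‖ ^ 2 = 4 * x := by rw [hx]; ring
  rw [hr2, Real.exp_neg]
  have hpi : 0 < Real.pi := Real.pi_pos
  have hex : 0 < Real.exp x := Real.exp_pos x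
  have hkey := sq_le_seven_tenths_mul_exp_sub_one hx0'.le
  rw [← sub_nonneg]
  have hid : 28 / 5 * ((8 * Real.pi)⁻¹ * ((1 - (Real.exp x)⁻¹) / x)) - (4 * Real.pi)⁻¹ * (Real.exp x)⁻¹ * (4 * x) =
      (7 * (Real.exp x - 1) - 10 * x ^ 2) / (10 * Real.pi * x * Real.exp x) := by
    field_simp
    ring
  rw [hid]
  apply div_nonneg
  · linarith
  · positivity

/-! ## Calculus of `w = G u` and of its angular derivative -/

/-- `‖D(Gu)(ξ)‖ ≤ M (1 + |ξ|) G(ξ)` when `|u|, ‖Du‖ ≤ M`. [folklore] -/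
theorem norm_fderiv_gauss_mul_le {u : EuclideanSpace ℝ (Fin 2) → ℝ} (hu : Differentiable ℝ u) {M : ℝ}
    (hM : ∀ ξ, |u ξ| ≤ M ∧ ‖fderiv ℝ u ξ‖ ≤ M) (ξ : EuclideanSpace ℝ (Fin 2)) :
    ‖fderiv ℝ (fun η => gaussVortexProfile η * u η) ξ‖ ≤ M * (1 + ‖ξ‖) * gaussVortexProfile ξ := by
  have hG : DifferentiableAt ℝ gaussVortexProfile ξ :=
    (contDiff_gaussVortexProfile (n := 1)).differentiable one_ne_zero ξ
  have hGp := gaussVortexProfile_pos ξ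
  have hM0 : 0 ≤ M := (abs_nonneg _).trans (hM ξ).1
  rw [fderiv_fun_mul hG (hu ξ)]
  calc ‖gaussVortexProfile ξ • fderiv ℝ u ξ + u ξ • fderiv ℝ gaussVortexProfile ξ‖
      ≤ ‖gaussVortexProfile ξ • fderiv ℝ u ξ‖ + ‖u ξ • fderiv ℝ gaussVortexProfile ξ‖ := norm_add_le _ _
    _ = gaussVortexProfile ξ * ‖fderiv ℝ u ξ‖ + |u ξ| * ‖fderiv ℝ gaussVortexProfile ξ‖ := by
        rw [norm_smul, norm_smul, Real.norm_eq_abs, Real.norm_eq_abs, abs_of_pos hGp]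
    _ ≤ gaussVortexProfile ξ * M + M * (gaussVortexProfile ξ / 2 * ‖ξ‖) := by
        gcongr
        · exact (hM ξ).2
        · exact (hM ξ).1
        · exact norm_fderiv_gaussVortexProfile_le ξ
    _ ≤ M * (1 + ‖ξ‖) * gaussVortexProfile ξ := by
        nlinarith [norm_nonneg ξ, mul_nonneg (mul_nonneg hM0 hGp.le) (norm_nonneg ξ)]

/-- The point reflection commutes with the derivative of an even function: `Dw(−ξ)[v] = −Dw(ξ)[v]`. [folklore] -/
theorem fderiv_neg_apply_of_even {w : EuclideanSpace ℝ (Fin 2) → ℝ} (hw : Differentiable ℝ w)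
    (heven : ∀ ξ, w (-ξ) = w ξ) (ξ v : EuclideanSpace ℝ (Fin 2)) :
    fderiv ℝ w (-ξ) v = -fderiv ℝ w ξ v := by
  have h1 : HasFDerivAt (w ∘ (-id : EuclideanSpace ℝ (Fin 2) → EuclideanSpace ℝ (Fin 2)))
      ((fderiv ℝ w ξ).comp (-ContinuousLinearMap.id ℝ (EuclideanSpace ℝ (Fin 2)))) (-ξ) := by
    have hd : HasFDerivAt w (fderiv ℝ w ξ) ((-id : EuclideanSpace ℝ (Fin 2) → EuclideanSpace ℝ (Fin 2)) (-ξ)) := by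
      simp only [Pi.neg_apply, id, neg_neg]
      exact (hw ξ).hasFDerivAt
    exact hd.comp (-ξ) ((hasFDerivAt_id (-ξ)).neg)
  have hcomp : (w ∘ (-id : EuclideanSpace ℝ (Fin 2) → EuclideanSpace ℝ (Fin 2))) = w := by
    funext x
    simp [Function.comp, heven]
  rw [hcomp] at h1
  rw [h1.fderiv]
  simp

/-- The operator norm of a functional on `ℝ²` is at most the sum of its values on the two basis vectors. [folklore] -/
theorem opNorm_le_of_single_fin_two (L : EuclideanSpace ℝ (Fin 2) →L[ℝ] ℝ) :
    ‖L‖ ≤ ‖L (EuclideanSpace.single 0 1)‖ + ‖L (EuclideanSpace.single 1 1)‖ := by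
  refine ContinuousLinearMap.opNorm_le_bound _ (by positivity) fun v => ?_
  have hv : v = v 0 • EuclideanSpace.single (0 : Fin 2) (1 : ℝ) + v 1 • EuclideanSpace.single (1 : Fin 2) (1 : ℝ) := by
    ext i; fin_cases i <;> simp
  have h0 : |v 0| ≤ ‖v‖ := abs_coord_le_norm_fin_two v 0
  have h1 : |v 1| ≤ ‖v‖ := abs_coord_le_norm_fin_two v 1
  calc ‖L v‖ = ‖v 0 * L (EuclideanSpace.single 0 1) + v 1 * L (EuclideanSpace.single 1 1)‖ := by
        conv_lhs => rw [hv]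
        rw [map_add, map_smul, map_smul, smul_eq_mul, smul_eq_mul]
    _ ≤ ‖v 0 * L (EuclideanSpace.single 0 1)‖ + ‖v 1 * L (EuclideanSpace.single 1 1)‖ := norm_add_le _ _
    _ = |v 0| * ‖L (EuclideanSpace.single 0 1)‖ + |v 1| * ‖L (EuclideanSpace.single 1 1)‖ := by
        rw [norm_mul, norm_mul, Real.norm_eq_abs (v 0), Real.norm_eq_abs (v 1)]
    _ ≤ ‖v‖ * ‖L (EuclideanSpace.single 0 1)‖ + ‖v‖ * ‖L (EuclideanSpace.single 1 1)‖ := by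
        gcongr
    _ = (‖L (EuclideanSpace.single 0 1)‖ + ‖L (EuclideanSpace.single 1 1)‖) * ‖v‖ := by ring

/-- The circle of radius `r`: `θ ↦ (r cos θ, r sin θ)` has velocity `perp` of its position. [folklore] -/
theorem hasDerivAt_circle (r θ : ℝ) :
    HasDerivAt (fun t : ℝ => (toLp 2 ![r * Real.cos t, r * Real.sin t] : EuclideanSpace ℝ (Fin 2)))
      (perp (toLp 2 ![r * Real.cos θ, r * Real.sin θ])) θ := by
  have h1 : HasDerivAt (fun t : ℝ => Real.cos t • (toLp 2 ![r, 0] : EuclideanSpace ℝ (Fin 2)) +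
      Real.sin t • (toLp 2 ![0, r] : EuclideanSpace ℝ (Fin 2)))
      ((-Real.sin θ) • (toLp 2 ![r, 0] : EuclideanSpace ℝ (Fin 2)) + Real.cos θ • (toLp 2 ![0, r] : EuclideanSpace ℝ (Fin 2))) θ :=
    ((Real.hasDerivAt_cos θ).smul_const _).add ((Real.hasDerivAt_sin θ).smul_const _)
  have hfun : (fun t : ℝ => (toLp 2 ![r * Real.cos t, r * Real.sin t] : EuclideanSpace ℝ (Fin 2))) =
      fun t : ℝ => Real.cos t • (toLp 2 ![r, 0] : EuclideanSpace ℝ (Fin 2)) +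
        Real.sin t • (toLp 2 ![0, r] : EuclideanSpace ℝ (Fin 2)) := by
    funext t; ext i; fin_cases i <;> simp <;> ring
  have hval : perp (toLp 2 ![r * Real.cos θ, r * Real.sin θ]) =
      (-Real.sin θ) • (toLp 2 ![r, 0] : EuclideanSpace ℝ (Fin 2)) + Real.cos θ • (toLp 2 ![0, r] : EuclideanSpace ℝ (Fin 2)) := by
    ext i; fin_cases i <;> simp [perp] <;> ring
  rw [hfun, hval]
  exact h1

/-- Elementary absorption: `|a b| ≤ 2 a²/r² + r² b²/8`-type AM–GM, in the form used for the coercivity constant. [folklore] -/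
theorem abs_mul_le_two_sq_div_add (a b r : ℝ) (hr : 0 < r) : |a| * |b| ≤ 2 * (a ^ 2 / r ^ 2) + r ^ 2 * b ^ 2 / 8 := by
  have hr2 : 0 < r ^ 2 := by positivity
  have ha : a ^ 2 = |a| ^ 2 := (sq_abs a).symm
  have hb : b ^ 2 = |b| ^ 2 := (sq_abs b).symm
  rw [ha, hb]
  have key : |a| * |b| = (2 * |a| / r) * (r * |b| / 2) := by field_simp
  rw [key]
  have amgm : ∀ x y : ℝ, x * y ≤ x ^ 2 / 2 + y ^ 2 / 2 := fun x y => by nlinarith [sq_nonneg (x - y)]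
  calc (2 * |a| / r) * (r * |b| / 2) ≤ (2 * |a| / r) ^ 2 / 2 + (r * |b| / 2) ^ 2 / 2 := amgm _ _
    _ = 2 * (|a| ^ 2 / r ^ 2) + r ^ 2 * |b| ^ 2 / 8 := by field_simp; ring

/-! ## The assembly -/

/-- **ROTATION COERCIVITY, Biot–Savart part** (`coreRotation_coercivity`; registered helper toward `stub_coreInverse`). [folklore] -/
theorem coreRotation_coercivity :
    ∀ u : EuclideanSpace ℝ (Fin 2) → ℝ, ContDiff ℝ 2 u → (∀ ξ, u (-ξ) = u ξ) →
      (∃ M : ℝ, ∀ ξ, |u ξ| ≤ M ∧ ‖fderiv ℝ u ξ‖ ≤ M ∧ ‖fderiv ℝ (fderiv ℝ u) ξ‖ ≤ M) →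
      let w : EuclideanSpace ℝ (Fin 2) → ℝ := fun η => gaussVortexProfile η * u η
      Integrable (fun ξ => ⟪ξ, biotSavart2D w ξ⟫ * fderiv ℝ w ξ (perp ξ)) ∧
        0 ≤ ∫ ξ, ⟪ξ, biotSavart2D w ξ⟫ * fderiv ℝ w ξ (perp ξ) ∧
        ∫ ξ, ⟪ξ, biotSavart2D w ξ⟫ * fderiv ℝ w ξ (perp ξ) ≤
          7 / 5 * ∫ ξ, (gaussVortexProfile ξ)⁻¹ * ((8 * Real.pi)⁻¹ * burgersPhi (‖ξ‖ ^ 2 / 4)) *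
            (fderiv ℝ w ξ (perp ξ)) ^ 2 := by
  intro u hu hue hM w
  obtain ⟨M, hM⟩ := hM
  have hM2 : ∀ ξ, |u ξ| ≤ M ∧ ‖fderiv ℝ u ξ‖ ≤ M := fun ξ => ⟨(hM ξ).1, (hM ξ).2.1⟩
  have hM0 : 0 ≤ M := (abs_nonneg _).trans (hM 0).1
  have hGpos : ∀ ξ : EuclideanSpace ℝ (Fin 2), 0 < gaussVortexProfile ξ := gaussVortexProfile_pos
  have hud : Differentiable ℝ u := hu.differentiable two_ne_zero
  have hw2 : ContDiff ℝ 2 w := (contDiff_gaussVortexProfile (n := 2)).mul hu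
  have hw1 : ContDiff ℝ 1 w := hw2.of_le one_le_two
  have hwd : Differentiable ℝ w := hw1.differentiable one_ne_zero
  -- the angular derivative `g = ∂_θ w`
  set g : EuclideanSpace ℝ (Fin 2) → ℝ := fun ξ => fderiv ℝ w ξ (perp ξ) with hg
  have hg_eq : ∀ ξ, g ξ = gaussVortexProfile ξ * fderiv ℝ u ξ (perp ξ) := fun ξ =>
    fderiv_gauss_mul_perp hud ξ
  have hg1 : ContDiff ℝ 1 g := contDiff_one_angularDeriv hw2
  -- Gaussian-class bounds: `|w| + ‖Dw‖ ≤ 2M(1+|η|) G`, `|g| + ‖Dg‖ ≤ 5M (1+|η|)² G`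
  have hwb : ∀ η, |w η| + ‖fderiv ℝ w η‖ ≤ 2 * M * (1 + ‖η‖) ^ 1 * gaussVortexProfile η := by
    intro η
    have h1 : |w η| ≤ M * gaussVortexProfile η := by
      show |gaussVortexProfile η * u η| ≤ _
      rw [abs_mul, abs_of_pos (hGpos η), mul_comm]
      exact mul_le_mul_of_nonneg_right (hM η).1 (hGpos η).le
    have h2 : ‖fderiv ℝ w η‖ ≤ M * (1 + ‖η‖) * gaussVortexProfile η := norm_fderiv_gauss_mul_le hud hM2 η
    have hG := hGpos η
    rw [pow_one]
    nlinarith [norm_nonneg η, mul_nonneg hM0 hG.le]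
  -- the angular derivative of `u` and `g = G · ∂_θu`
  set θu : EuclideanSpace ℝ (Fin 2) → ℝ := fun ξ => fderiv ℝ u ξ (perp ξ) with hθu
  have hθu1 : ContDiff ℝ 1 θu := contDiff_one_angularDeriv hu
  have hgfun : g = fun ξ => gaussVortexProfile ξ * θu ξ := funext hg_eq
  have hθub : ∀ η, |θu η| ≤ M * ‖η‖ := fun η => by
    have := norm_angularDeriv_le_of_coreBound hM η
    rwa [Real.norm_eq_abs] at this
  have hDθub : ∀ η, ‖fderiv ℝ θu η‖ ≤ 2 * M * (1 + ‖η‖) := fun η => by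
    have h0 := norm_fderiv_angularDeriv_single_le_of_coreBound hu hM η 0
    have h1 := norm_fderiv_angularDeriv_single_le_of_coreBound hu hM η 1
    have := opNorm_le_of_single_fin_two (fderiv ℝ θu η)
    linarith
  have hgb : ∀ η, |g η| + ‖fderiv ℝ g η‖ ≤ 3 * M * (1 + ‖η‖) ^ 2 * gaussVortexProfile η := by
    intro η
    have hG := hGpos η
    have hr := norm_nonneg η
    have h1 : |g η| ≤ M * ‖η‖ * gaussVortexProfile η := by
      rw [hg_eq, abs_mul, abs_of_pos hG]
      nlinarith [hθub η]
    have hGd : DifferentiableAt ℝ gaussVortexProfile η :=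
      (contDiff_gaussVortexProfile (n := 1)).differentiable one_ne_zero η
    have hθd : DifferentiableAt ℝ θu η := (hθu1.differentiable one_ne_zero) η
    have h2 : ‖fderiv ℝ g η‖ ≤ gaussVortexProfile η * (2 * M * (1 + ‖η‖)) + M * ‖η‖ * (gaussVortexProfile η / 2 * ‖η‖) := by
      rw [hgfun, fderiv_fun_mul hGd hθd]
      calc ‖gaussVortexProfile η • fderiv ℝ θu η + θu η • fderiv ℝ gaussVortexProfile η‖
          ≤ ‖gaussVortexProfile η • fderiv ℝ θu η‖ + ‖θu η • fderiv ℝ gaussVortexProfile η‖ := norm_add_le _ _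
        _ = gaussVortexProfile η * ‖fderiv ℝ θu η‖ + |θu η| * ‖fderiv ℝ gaussVortexProfile η‖ := by
            rw [norm_smul, norm_smul, Real.norm_eq_abs, Real.norm_eq_abs, abs_of_pos hG]
        _ ≤ gaussVortexProfile η * (2 * M * (1 + ‖η‖)) + M * ‖η‖ * (gaussVortexProfile η / 2 * ‖η‖) := by
            gcongr
            · exact hDθub η
            · exact hθub η
            · exact norm_fderiv_gaussVortexProfile_le η
    have hMG : 0 ≤ M * gaussVortexProfile η := mul_nonneg hM0 hG.le
    nlinarith [mul_nonneg hMG hr, mul_nonneg (mul_nonneg hMG hr) hr]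
  -- `w` is even, hence `g` is even
  have hweven : ∀ ξ, w (-ξ) = w ξ := fun ξ => by
    show gaussVortexProfile (-ξ) * u (-ξ) = gaussVortexProfile ξ * u ξ
    rw [hue ξ, gaussVortexProfile, gaussVortexProfile, norm_neg]
  have hgeven : ∀ η, g (-η) = g η := fun η => by
    show fderiv ℝ w (-η) (perp (-η)) = fderiv ℝ w η (perp η)
    rw [fderiv_neg_apply_of_even hwd hweven, perp_neg, map_neg, neg_neg]
  -- `g` is neutral: `∫ ∂_θw = 0`
  have hgint0 : ∫ η, g η = 0 := by
    refine integral_fderiv_perp_eq_zero w hw1 ?_ ?_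
    · refine integrable_of_le_one_add_norm_pow_mul_gauss (continuous_norm.mul hw1.continuous) (A := M) (N := 1)
        (fun z => ?_)
      have hG := hGpos z
      have h1 : |w z| ≤ M * gaussVortexProfile z := by
        show |gaussVortexProfile z * u z| ≤ _
        rw [abs_mul, abs_of_pos hG, mul_comm]
        exact mul_le_mul_of_nonneg_right (hM z).1 hG.le
      rw [Real.norm_eq_abs, abs_mul, abs_norm, pow_one]
      nlinarith [norm_nonneg z, abs_nonneg (w z), mul_nonneg hM0 hG.le]
    · refine integrable_of_le_one_add_norm_pow_mul_gauss (continuous_norm.mul (hw1.continuous_fderiv one_ne_zero).norm)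
        (A := M) (N := 2) (fun z => ?_)
      have hG := hGpos z
      have h2 : ‖fderiv ℝ w z‖ ≤ M * (1 + ‖z‖) * gaussVortexProfile z := norm_fderiv_gauss_mul_le hud hM2 z
      rw [Real.norm_eq_abs, abs_mul, abs_norm, abs_norm]
      nlinarith [norm_nonneg z, norm_nonneg (fderiv ℝ w z), mul_nonneg hM0 hG.le,
        mul_nonneg (mul_nonneg hM0 hG.le) (norm_nonneg z)]
  -- `g` has zero circular means: `∮ ∂_θw dθ = [w]` around the circle
  have hgmean : ∀ r, 0 < r → ∫ θ in (0:ℝ)..(2 * Real.pi), g (toLp 2 ![r * Real.cos θ, r * Real.sin θ]) = 0 := by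
    intro r _
    have hderiv : ∀ θ : ℝ, HasDerivAt (fun t : ℝ => w (toLp 2 ![r * Real.cos t, r * Real.sin t]))
        (g (toLp 2 ![r * Real.cos θ, r * Real.sin θ])) θ := by
      intro θ
      have hwd' : HasFDerivAt w (fderiv ℝ w (toLp 2 ![r * Real.cos θ, r * Real.sin θ]))
          (toLp 2 ![r * Real.cos θ, r * Real.sin θ]) := (hwd _).hasFDerivAt
      exact hwd'.comp_hasDerivAt θ (hasDerivAt_circle r θ)
    have hcont : Continuous fun θ : ℝ => g (toLp 2 ![r * Real.cos θ, r * Real.sin θ]) := by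
      refine hg1.continuous.comp ?_
      exact (PiLp.continuous_toLp 2 _).comp (continuous_pi fun i => by
        fin_cases i
        · exact continuous_const.mul Real.continuous_cos
        · exact continuous_const.mul Real.continuous_sin)
    rw [intervalIntegral.integral_eq_sub_of_hasDerivAt (fun θ _ => hderiv θ) (hcont.intervalIntegrable _ _)]
    simp [Real.cos_two_pi, Real.sin_two_pi]
  -- the logarithmic potential of `g`
  have hlp := logPotential_neutral_energy 2 (3 * M) g hg1 hgb hgint0 hgeven hgmean
  obtain ⟨hψ1, hψe, hψm, hψgrad, hψg, henergy⟩ := hlp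
  set ψ : EuclideanSpace ℝ (Fin 2) → ℝ := fun ξ => ∫ η, (2 * Real.pi)⁻¹ * Real.log ‖ξ - η‖ * g η with hψ
  -- `ξ·(K∗w)(ξ) = −ψ(ξ)`
  have hid : ∀ ξ, ⟪ξ, biotSavart2D w ξ⟫ = -ψ ξ := fun ξ =>
    (inner_id_biotSavart2D_eq_neg_logConv_angularDeriv 1 (2 * M) w hw1 hwb ξ).2
  -- the pairing `J = ∫ (ξ·K∗w) ∂_θw = −∫ ψ g = ‖∇ψ‖²`
  have hJfun : (fun ξ => ⟪ξ, biotSavart2D w ξ⟫ * fderiv ℝ w ξ (perp ξ)) = fun ξ => -(ψ ξ * g ξ) := by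
    funext ξ; rw [hid ξ]; simp only [hg]; ring
  have hJint : Integrable (fun ξ => ⟪ξ, biotSavart2D w ξ⟫ * fderiv ℝ w ξ (perp ξ)) := by
    rw [hJfun]; exact hψg.neg
  have hJval : ∫ ξ, ⟪ξ, biotSavart2D w ξ⟫ * fderiv ℝ w ξ (perp ξ) = ∫ ξ, ‖gradient ψ ξ‖ ^ 2 := by
    rw [hJfun, integral_neg, henergy]
  refine ⟨hJint, ?_, ?_⟩
  · rw [hJval]; exact integral_nonneg fun ξ => by positivity
  -- the coercivity constant: `P ≤ 2·∫ψ²/r² + (7/10)Θ ≤ P/2 + (7/10)Θ`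
  obtain ⟨hHW1, hHW2⟩ := hardyWirtinger_even ψ hψ1 hψe hψm hψgrad
  have hΘint : Integrable fun ξ => (gaussVortexProfile ξ)⁻¹ * ((8 * Real.pi)⁻¹ * burgersPhi (‖ξ‖ ^ 2 / 4)) * g ξ ^ 2 := by
    have hcont : Continuous fun ξ : EuclideanSpace ℝ (Fin 2) =>
        (gaussVortexProfile ξ)⁻¹ * ((8 * Real.pi)⁻¹ * burgersPhi (‖ξ‖ ^ 2 / 4)) * g ξ ^ 2 := by
      refine ((contDiff_gaussVortexProfile (n := 0)).continuous.inv₀ fun ξ => (hGpos ξ).ne').mul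
        (continuous_const.mul ?_) |>.mul (hg1.continuous.pow 2)
      exact (contDiff_burgersPhi (n := 0)).continuous.comp ((continuous_norm.pow 2).div_const 4)
    refine integrable_of_le_one_add_norm_pow_mul_gauss hcont (A := (8 * Real.pi)⁻¹ * M ^ 2) (N := 2) (fun z => ?_)
    have hG := hGpos z
    have hφ0 : 0 < burgersPhi (‖z‖ ^ 2 / 4) := burgersPhi_pos _
    have hφ1 : burgersPhi (‖z‖ ^ 2 / 4) ≤ 1 := burgersPhi_le_one (by positivity)
    rw [Real.norm_eq_abs, abs_of_nonneg (by positivity), hg_eq z, mul_pow]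
    have hθ2 : θu z ^ 2 ≤ (M * ‖z‖) ^ 2 := by
      have := hθub z
      rw [← sq_abs (θu z)]
      exact pow_le_pow_left₀ (abs_nonneg _) this 2
    have e1 : (gaussVortexProfile z)⁻¹ * ((8 * Real.pi)⁻¹ * burgersPhi (‖z‖ ^ 2 / 4)) *
        (gaussVortexProfile z ^ 2 * θu z ^ 2) =
        (8 * Real.pi)⁻¹ * burgersPhi (‖z‖ ^ 2 / 4) * gaussVortexProfile z * θu z ^ 2 := by
      field_simp
    rw [e1]
    have hr : ‖z‖ ^ 2 ≤ (1 + ‖z‖) ^ 2 := by nlinarith [norm_nonneg z]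
    calc (8 * Real.pi)⁻¹ * burgersPhi (‖z‖ ^ 2 / 4) * gaussVortexProfile z * θu z ^ 2
        ≤ (8 * Real.pi)⁻¹ * 1 * gaussVortexProfile z * (M * ‖z‖) ^ 2 := by
          gcongr
      _ = (8 * Real.pi)⁻¹ * M ^ 2 * (‖z‖ ^ 2 * gaussVortexProfile z) := by ring
      _ ≤ (8 * Real.pi)⁻¹ * M ^ 2 * ((1 + ‖z‖) ^ 2 * gaussVortexProfile z) := by
          gcongr
  -- pointwise absorption inequality
  have hpt : ∀ ξ, -(ψ ξ * g ξ) ≤ 2 * (ψ ξ ^ 2 / ‖ξ‖ ^ 2) +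
      7 / 10 * ((gaussVortexProfile ξ)⁻¹ * ((8 * Real.pi)⁻¹ * burgersPhi (‖ξ‖ ^ 2 / 4)) * g ξ ^ 2) := by
    intro ξ
    by_cases hξ : ξ = 0
    · subst hξ
      have hp0 : perp (0 : EuclideanSpace ℝ (Fin 2)) = 0 := by ext i; fin_cases i <;> simp [perp]
      have hg0 : g 0 = 0 := by show fderiv ℝ w 0 (perp 0) = 0; rw [hp0, map_zero]
      rw [hg0]; simp
    have hr : 0 < ‖ξ‖ := norm_pos_iff.2 hξ
    have hG := hGpos ξ
    have h1 : -(ψ ξ * g ξ) ≤ |ψ ξ| * |g ξ| := by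
      rw [← abs_mul]; exact neg_le_abs _ |>.trans (le_of_eq (abs_neg _).symm) |>.trans (le_of_eq (by rw [neg_mul_eq_neg_mul]; simp))
    have h2 := abs_mul_le_two_sq_div_add (ψ ξ) (g ξ) ‖ξ‖ hr
    -- `r² g² ≤ (28/5) G⁻¹ Ω g²`
    have hsc := gaussVortexProfile_mul_sq_le_omega ξ
    have h3 : ‖ξ‖ ^ 2 * g ξ ^ 2 / 8 ≤
        7 / 10 * ((gaussVortexProfile ξ)⁻¹ * ((8 * Real.pi)⁻¹ * burgersPhi (‖ξ‖ ^ 2 / 4)) * g ξ ^ 2) := by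
      have e : ‖ξ‖ ^ 2 * g ξ ^ 2 = (gaussVortexProfile ξ * ‖ξ‖ ^ 2) * ((gaussVortexProfile ξ)⁻¹ * g ξ ^ 2) := by
        field_simp
      rw [e]
      have hnn : 0 ≤ (gaussVortexProfile ξ)⁻¹ * g ξ ^ 2 := by positivity
      nlinarith [mul_le_mul_of_nonneg_right hsc hnn]
    linarith
  have hP : ∫ ξ, ‖gradient ψ ξ‖ ^ 2 ≤ 2 * (∫ ξ, ψ ξ ^ 2 / ‖ξ‖ ^ 2) +
      7 / 10 * ∫ ξ, (gaussVortexProfile ξ)⁻¹ * ((8 * Real.pi)⁻¹ * burgersPhi (‖ξ‖ ^ 2 / 4)) * g ξ ^ 2 := by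
    rw [henergy, ← integral_neg, ← integral_const_mul, ← integral_const_mul,
      ← integral_add (hHW1.const_mul 2) (hΘint.const_mul _)]
    exact integral_mono hψg.neg ((hHW1.const_mul 2).add (hΘint.const_mul _)) hpt
  rw [hJval]
  show ∫ ξ, ‖gradient ψ ξ‖ ^ 2 ≤ 7 / 5 * ∫ ξ, (gaussVortexProfile ξ)⁻¹ * ((8 * Real.pi)⁻¹ * burgersPhi (‖ξ‖ ^ 2 / 4)) * g ξ ^ 2
  linarith

end Summit.AnomalousDissipation.AnomalousDissipation.Theorems.MarginalStabilityChainStretchedVortexRows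

end
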